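/-
Copyright (c) 2026 the pub-hodgecm-mathlib formalisation cell (harness21).  Typer seat hodgecm-mathlib-TN-t01 (g2), carpet-typing squad
TN «LN ∕ LS transfer» (SEATPLAN-GO500 v1 §2; TN-plan DEAL v7, 2026-09-02).
-/
import Mathlib.NumberTheory.LocalField.Basic
import Mathlib.LinearAlgebra.Matrix.GeneralLinearGroup.Defs
import Mathlib.MeasureTheory.Measure.Haar.Basic
import Mathlib.MeasureTheory.Integral.Bochner.Basic
import Mathlib.Topology.LocallyConstant.Basic
import Mathlib.Topology.Algebra.InfiniteSum.Basic
import Mathlib.Analysis.Complex.Basic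
import Mathlib.Algebra.Group.AddChar
import Mathlib.Analysis.Real.Sqrt
import Mathlib.Data.Set.Card
import Literature.NumberTheory.GaloisRepresentations.LocalField
import Literature.NumberTheory.Automorphic.ReductiveGroupData
import Literature.NumberTheory.Automorphic.LocalFieldHaarBalls
import Mathlib.Analysis.SpecificLimits.Normed
import HarnessLib

/-!
# Labesse–Langlands (1979), §2 «Local theory»: the normalised `κ`-orbital integrals `Φ^T(γ, f)` on `SL(2)` and its
# forms `G' = {g ∈ GL₂(F) | det g ∈ A}`, Lemma 2.1 (smooth extension across the centre), Definitions 2.2–2.3, the tree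
# computation (2.1)–(2.2) with the shell indices `δ_m`, its supplement for the unit element, Lemmas 2.4–2.6 /
# Corollary 2.7 / Lemma 2.8 (restriction from `GL₂(F)` to `G'`), the character identities (2.4)–(2.5) and the
# definition of `L`-indistinguishability with the size `1, 2, 4` of the classes — AS NAMED FACTS and carriers

J.-P. Labesse, R. P. Langlands, *L-indistinguishability for SL(2)*, Canad. J. Math. **31** (1979) 726–785
[LabesseLanglands1979], §2 = printed pp. 729–743.  TEXT = the authors' retyped IAS reissue, held as
`paper:doi-10-4153-cjm-1979-070-3` (69 pp., OWN pagination 1–69; §2 = typescript pp. 3–17).  Every page pin below is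
«(typescript p. N)» = file `pNNNN.txt` of that text; the tree's ≈ 700 existing provenance tags `[cite: LabesseLanglands1979,
§2 p. 7/8/9/10]`, `§2 (2.1)/(2.2)`, `§2 Lemma 2.1 pp. 8–9` (230 files under `Literature/NumberTheory/Rogawski1990/`,
`Literature/GroupTheory/`, `Literature/Topology/`) use THE SAME typescript pagination.  The printed Canad. J. Math. page of a
typescript page is not held (no fixed offset: 60 printed pp. vs 69 typescript pp.); items are pinned by their printed NUMBER
(Lemma 2.1, Definition 2.2, (2.1) …), which is edition-independent.

Squad TN (HCML «GO 500»), DEAL v7 (TN-plan 2026-09-02T03:10:56Z): «the definitions and statements of §2 the consumers cite».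
Topic `NumberTheory/Automorphic/LabesseLanglands1979`, namespace `Literature.NumberTheory.Automorphic.LabesseLanglands1979.Sec2`.
STATEMENTS (named facts) + REAL definitions + four short THEOREMS; no `sorry`, no `axiom`, no `instance`, no `notation`.
Kinds of declarations (COORDINATION NOTE 1 (b) of the squad; review p848627): PREDICATES ON EXPLICITLY GIVEN DATA (the print's
objects are parameters; consumers instantiate with their data; nothing is claimed for all data over bare carriers; marked
«PREDICATE»), REAL definitions (print's own definitions, with their printed bodies), and the four CLOSED displayed computations ∕
identities of §2 that are elementary — these are PROVED here (marked «THEOREM»), not vendored as facts (D-0014 ∕ D-0026).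

## CENSUS «what the consumers state §2 as» (rg over `Summits/HodgeConjecture` and `Literature`, 2026-09-02)
* `Summits/HodgeConjecture/…/Cruxes/H413/Lines/F0_P3a_N6nsGerm.lean` ll. 312–336, 491–493 (stubs `stub_N6nsR1ramWild`,
  `stub_N6nsR1ram`, `stub_N6nsR1LL`, all PAID in-house): the rank-one UNSTABLE transfer letters ★
  `Rogawski1990.RankOneUnstableTransferNonsplitCME[Ramified[Wild]]` cite `[LabesseLanglands1979, §2]` as «Labesse–Langlands
  (2.1)∕(2.2) on the tree of `SL₂(L⁺_v)`, uniform in the residue characteristic» and «the unstable `U(1,1)` orbital integral ×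
  `μ⁻¹(x − y)D` is eventually constant at the centre» = (2.1), (2.2) and Lemma 2.1 below (`μ⁻¹(x−y)D` is Rogawski's `d(γ)`).
* `Summits/…/Theorems/F0P3aR1lcObstruction.lean` :19, :57 (`not_rankOneUnstableTransferNonsplit`): the UNGUARDED letter is false —
  print's guard is p. 5 «assume that if `T` is not split then `κ'` is not trivial» (field `OrbitalSetup.κ` below is that `κ'`).
* `Literature/NumberTheory/Rogawski1990/RankOne*.lean`, `…/Automorphic/SLTwoTreeQuadraticTorusShell*.lean` (≈ 200 files, road «W′»):
  «§2 p. 8» = the unfolding `∫_{T∖G} f = Σ_m δ_m ∫_K f(k⁻¹ α_m⁻¹ t α_m k)` with `δ_m = 2q^m` (ramified) ∕ `(q+1)q^{m−1}` (unramified)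
  = `shellIndex` and `LabesseLanglands1979_2_eq_2_1_shellExpansion` below; the tree PROVES the count `2q^m` in its CM currency
  (★ `HermitianLatticeTree.ncard_setOf_glVertexAct_torus_eq_self_sep_shellIndex`, ★ `exists_shellIndex`).
* `Literature/NumberTheory/Rogawski1990/RankOneUnstableDeltaSymbolTorusCoordinates.lean`: «§2 (2.1)–(2.2)» = the coordinates
  `γ = a + bτ`, `τ² = uτ + v`, `γ₁ − γ₂ = b(τ − τ̄)` of p. 6 (`dFactorCoord`, `shellMatrix` below) and (2.2).
* `Literature/Topology/LocallyConstantCompactFamily.lean`, `Literature/GroupTheory/FixedPointsShellValueLaw.lean`: «§2» = local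
  constancy of parameter integrals ∕ the fixed-point shell value law (Kottwitz's reading of p. 8) — in-house theorems.
Nobody cites Lemmas 2.4–2.8, Corollary 2.7, (2.4)–(2.5) or the definition of `L`-indistinguishability today; they are typed
here because they ARE §2's numbered statements (DEAL v7 «L-packets ∕ L-indistinguishability for SL(2)»).

## Index (print item ↦ declaration ↦ typescript page)
| item | declaration | p. |
|---|---|---|
| `G' = {g ∈ GL₂(F) ∣ det g ∈ A}` | `GPrime` (REAL) | 4 |
| `D(T') ≃ F^×∕A·Nm_{L∕F}L^×`, «either trivial or of order two» | `DTQuot` (REAL), `LabesseLanglands1979_2_DT_orderLeTwo` (PREDICATE) | 4 |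
| `Φ^δ(γ,f)`, `Φ^T(γ,f) = d(γ) Σ_{D(T')} κ'(δ) Φ^δ(γ,f)` | `OrbitalSetup` (carrier), `OrbitalSetup.PhiT` (REAL) | 5 |
| `d(γ)` split ∕ `Δ(γ)` of (2.4); `d(γ)` non-split | `deltaFactor`, `dFactorCoord` (REAL) | 5, 14 |
| **Lemma 2.1** | `LabesseLanglands1979_2_1_smoothExtension` (PREDICATE; non-archimedean dress) | 5 |
| `γ(a) = a(1 1; 0 1)`, `κ#(h)` | `unipotentScalar`, `kappaSharp` (REAL); `LabesseLanglands1979_2_kappaSharp_wellDefined` (THEOREM) | 6–7 |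
| **Definition 2.2**, **Definition 2.3** | `centralValueSplit`, `centralValueNonsplit` (REAL) | 6, 7 |
| `G(O_F)`, `f(k⁻¹gk) = κ'(det k)f(g)` | ★ `Literature.NumberTheory.Automorphic.glInt 2 F` (cited, not restated); `IsKappaSpherical` (REAL) | 8 |
| `δ_m` | `shellIndex` (REAL) | 8 |
| **(2.1)** | `shellMatrix` (REAL), `LabesseLanglands1979_2_eq_2_1_shellExpansion` (PREDICATE) | 8–9 |
| **(2.2)** `∫_{|x|<|ϖ|^N} κ'(x)dx = 0` (L ramified) | `LabesseLanglands1979_2_eq_2_2_ramifiedVanishing` (THEOREM) | 9 |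
| `Σ_m κ'(bϖ^m)|bϖ^m| = κ'(b)|b|∕(1+q⁻¹)` (L unramified) | `LabesseLanglands1979_2_eq_2_2_unramifiedSum` (THEOREM) | 9 |
| supplement: `Φ^T(γ,f⁰) = 0` (ramified); `= 0` unless `γ` unit, `= (meas T(O_F))⁻¹` (unramified) | `LabesseLanglands1979_2_supplement_ramified`, `…_unramified` (PREDICATE), `…_supplement_identity` (THEOREM) | 9–10 |
| **Lemma 2.4**, **Lemma 2.5**, **Lemma 2.6** | `RestrictionDatum` (carrier), `LabesseLanglands1979_2_4_…`, `_2_5_…`, `_2_6_…` (PREDICATE) | 10–11 |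
| `G(π')`, `X(π̃)` | `RestrictionDatum.GOf`, `RestrictionDatum.XSet` (REAL) | 12 |
| **Corollary 2.7**, **Lemma 2.8** | `LabesseLanglands1979_2_7_…`, `LabesseLanglands1979_2_8_…` (PREDICATE) | 13 |
| **(2.4)** (from [11] Lemma 5.18) | `LabesseLanglands1979_2_eq_2_4_characterDifference` (PREDICATE) | 14 |
| **(2.5)** | `OrbitalSetup.adjointPhiT` (REAL), `LabesseLanglands1979_2_eq_2_5_adjointOnCharacters` (PREDICATE) | 15 |
| definition of `L`-indistinguishability; «in other words»; partition into finite sets | `RestrictionDatum.IsLIndistinguishable` (REAL), `LabesseLanglands1979_2_lindist_iff_conj`, `…_lindist_partition` (PREDICATE) | 15 |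
| «an L-indistinguishable class consists of 1, 2, or 4 elements» | `LabesseLanglands1979_2_lindist_classCard` (PREDICATE) | 16 |
| `Π(θ') = Π⁺(θ') ∪ Π⁻(θ')`, «`Π(θ₁') = Π(θ₂')` iff `θ₁' = θ₂'` or `θ̄₁' = θ₂'`» | `LabesseLanglands1979_2_packet_eq_iff` (PREDICATE) | 17 |

NOT TYPED (census): the archimedean dress of Lemma 2.1 (`F = ℝ`, smoothness `C^∞` on `T'(ℝ)`; print defers to Harish-Chandra [4],
p. 8) — only the non-archimedean reading «smooth = locally constant» is typed; Haar measures `|ω_γ|` on the orbits (from [9]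
Lemma 6.1 ∕ p. 77) and the orbit `O(γ(a))` are the PARAMETER `orbInt` (no invariant measures on conjugacy classes of `p`-adic
groups in Mathlib); the Weil representation `π(θ)` of [6] Thm 4.6, the labelling `π^±(θ)` of [11] Lemma 5.18, Whittaker models
`Ind(G', N(F), ψ')` and «irreducible admissible representation» are carriers of `RestrictionDatum` ∕ parameters (concrete
currency available in the tree: ★ `Representation.IsSmooth` ∕ `IsAdmissible` in `Literature/NumberTheory/Automorphic/SmoothRepresentation.lean`);
the proofs on pp. 10–14 and the discussion of the three fields `L₁, L₂, L₃` (p. 16) are not statements.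

## References
* [LabesseLanglands1979] J.-P. Labesse, R. P. Langlands, *L-indistinguishability for SL(2)*, Canad. J. Math. 31 (1979)
  726–785; §2 «Local theory» = typescript pp. 3–17 of `paper:doi-10-4153-cjm-1979-070-3`.
* [6] = [JacquetLanglands1970] (Whittaker models, `π(θ)`, Lemma 7.3.2); [9] = Langlands, *Modular forms and ℓ-adic
  representations*; [11] = Langlands, *Base change for GL(2)* (Lemmas 5.16, 5.18); [12] = Langlands, *Stable conjugacy*;
  [13] = Langlands, *On Artin's L-functions* (the factor `λ(L∕F, ψ)`) — as numbered in the source's bibliography (pp. 68–69).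
-/

noncomputable section

open scoped ValuativeRel NNReal
open _root_.MeasureTheory

namespace Literature.NumberTheory.Automorphic.LabesseLanglands1979.Sec2

open Literature.NumberTheory.GaloisRepresentations.IsNonarchimedeanLocalField
  (normAbs residueFieldCard residueFieldCard_ne_zero one_lt_residueFieldCard)

universe u v w

/-! ## The groups `G'`, `T'`, `D(T')` (typescript pp. 3–5) -/

section Groups

variable (F : Type u) [Field F]

/-- **`G' = {g ∈ G̃(F) = GL₂(F) ∣ det g ∈ A}`** for a subgroup `A` of `F^×` (typescript p. 4: «it is best simply to take a
closed subgroup `A` of `F^×` and to let `G' = {g ∈ G̃(F) ∣ det g ∈ A}`»; `A = 1` gives `G = SL₂(F)`).  Closedness of `A` is not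
part of the definition of the subgroup. [cite: LabesseLanglands1979, §2 (typescript p. 4)] -/
def GPrime (A : Subgroup Fˣ) : Subgroup (GL (Fin 2) F) :=
  A.comap Matrix.GeneralLinearGroup.det

/-- **`D(T') = T(F)∖G̃(F)∕G' ≃ F^× ∕ A·Nm_{L∕F}L^×`** (typescript p. 4), as the quotient of `F^×` by `A ⊔ N`, `N` the norm
subgroup `{Nm_{L∕F} x ∣ x ∈ L^×}` of the quadratic algebra `L` of `T` (`N = F^×` when `T` is split, p. 4 (a)).
[cite: LabesseLanglands1979, §2 (typescript p. 4)] -/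
abbrev DTQuot (A N : Subgroup Fˣ) : Type u :=
  Fˣ ⧸ (A ⊔ N)

/-- «It is a group, and is either trivial or of order two» (typescript p. 4), said of `D(T') ≃ F^×∕A·Nm_{L∕F}L^×` for `F` a
LOCAL field of characteristic zero and `N = Nm_{L∕F}L^×` (local class field theory: `[F^× : Nm L^×] = 2` for a quadratic field
extension `L`).  PREDICATE on `(A, N)`: consumers instantiate `N` with the norm group of their quadratic `L`.
[cite: LabesseLanglands1979, §2 (typescript p. 4)] -/
def LabesseLanglands1979_2_DT_orderLeTwo (A N : Subgroup Fˣ) : Prop :=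
  Nat.card (DTQuot F A N) = 1 ∨ Nat.card (DTQuot F A N) = 2

end Groups

/-! ## The normalising factor `d(γ)` (typescript pp. 5–6, 14) -/

section DFactor

variable {F : Type u} [Field F] {L : Type v} [CommRing L]

/-- **`Δ(γ) = |(γ₁ − γ₂)²|^{1∕2} ∕ |γ₁γ₂|^{1∕2}`** (typescript p. 5: `d(γ)` for `T` split; p. 14: the `Δ(γ)` of (2.4)), for the
eigenvalues `γ₁, γ₂ ∈ L` of a regular `γ` and an absolute value `abs` on `L` (both `(γ₁−γ₂)²` and `γ₁γ₂` lie in `F`; print's `|·|`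
is `|·|_F`, so instantiate `abs` with an absolute value of `L` whose restriction to `F` is `|·|_F`; junk value `0` when
`γ₁γ₂ = 0`, which does not occur for `γ ∈ T(F) ⊆ GL₂(F)`). [cite: LabesseLanglands1979, §2 (typescript p. 5)] -/
def deltaFactor (abs : L →*₀ ℝ≥0) (γ₁ γ₂ : L) : ℝ≥0 :=
  NNReal.sqrt (abs ((γ₁ - γ₂) ^ 2)) / NNReal.sqrt (abs (γ₁ * γ₂))

/-- **`d(γ) = λ(L∕F, ψ) · κ'((γ₁ − γ₂)∕(γ₁⁰ − γ₂⁰)) · |(γ₁ − γ₂)²|^{1∕2} ∕ |γ₁γ₂|^{1∕2}`** for `T` NOT split (typescript p. 5),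
written in the coordinates of p. 6: `L = F(τ)`, `τ² = uτ + v`, `γ = a + bτ` (eigenvalues `γ₁ = a + bτ`, `γ₂ = a + bτ̄`,
`γ₁ − γ₂ = b(τ − τ̄)`), the fixed regular `γ⁰ = a⁰ + b⁰τ`; hence `(γ₁ − γ₂)∕(γ₁⁰ − γ₂⁰) = b∕b⁰ ∈ F`, `(γ₁ − γ₂)² = b²(u² + 4v)`,
`γ₁γ₂ = Nm γ = a² + abu − b²v`.  Parameters: `lam = λ(L∕F, ψ) ∈ ℂ` (the factor of [13]), `κ : F → ℂ` the non-trivial character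
of `F^×∕Nm L^×` (its value at `0` is never used: `b, b⁰ ≠ 0` for regular elements), `abs = |·|_F`.  «Different choices of `ψ`
and `γ⁰` lead either to `d(γ)` once again or to `−d(γ)`» (p. 5) is not typed. [cite: LabesseLanglands1979, §2 (typescript pp. 5–6)] -/
def dFactorCoord (lam : ℂ) (κ : F → ℂ) (abs : F →*₀ ℝ≥0) (u v b₀ a b : F) : ℂ :=
  lam * κ (b / b₀) *
    ((NNReal.sqrt (abs (b ^ 2 * (u ^ 2 + 4 * v))) / NNReal.sqrt (abs (a ^ 2 + a * b * u - b ^ 2 * v)) : ℝ≥0) : ℂ)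

end DFactor

/-! ## `Φ^T(γ, f)`, Lemma 2.1, Definitions 2.2–2.3 (typescript pp. 5–8) -/

/-- The data of typescript p. 5 for ONE Cartan subgroup: `T` (print's `T'`, a topological group in applications), its
regular elements `reg`, the finite set `D` (print's `D(T')`, of order 1 or 2), the character `κ : D → ℂ` (print's `κ'`;
p. 5 «we … assume that if `T` is not split then `κ'` is not trivial»), a type `Φf` of test functions (print: smooth compactly
supported `f` on `G'`), the orbital integrals `Phi δ γ f = Φ^δ(γ, f) = ∫_{h⁻¹T'h∖G'} f(g⁻¹h⁻¹γhg) dg` (`δ` the image of `h`), and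
the factor `d : T → ℂ` (print's `d(γ)`: `deltaFactor` ∕ `dFactorCoord`).  CARRIER only (no axioms): the Haar measures and the
integrals defining `Φ^δ` are not typed. [cite: LabesseLanglands1979, §2 (typescript p. 5)] -/
structure OrbitalSetup (T : Type u) (D : Type v) (Φf : Type w) where
  /-- the regular elements of `T'` -/
  reg : Set T
  /-- `κ' : D(T') → ℂ` -/
  κ : D → ℂ
  /-- `Φ^δ(γ, f)` -/
  Phi : D → T → Φf → ℂ
  /-- `d(γ)` -/
  d : T → ℂ

namespace OrbitalSetup

variable {T : Type u} {D : Type v} {Φf : Type w}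

/-- **`Φ^T(γ, f) = Φ^T_{κ'}(γ, f) = d(γ) Σ_{δ ∈ D(T')} κ'(δ) Φ^δ(γ, f)`** (typescript p. 5), for `γ` regular in `T'`.
[cite: LabesseLanglands1979, §2 (typescript p. 5)] -/
def PhiT [Fintype D] (S : OrbitalSetup T D Φf) (γ : T) (f : Φf) : ℂ :=
  S.d γ * ∑ δ, S.κ δ * S.Phi δ γ f

/-- The map «adjoint to `f ↦ Φ^T(f)`» on a character `θ'` of `T'` (typescript pp. 10, 15): the distribution
`f ↦ ∫_{T'} θ'(γ) Φ^T(γ, f) dγ` (`μ` the Haar measure of `T'`; by Lemma 2.1 the integrand extends to a compactly supported locally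
constant function, and `T' ∖ reg` is the set of scalars `F^× ∩ T'`, Haar-null in `T'`). [cite: LabesseLanglands1979, §2 (typescript pp. 10; 15)] -/
def adjointPhiT [Fintype D] [MeasurableSpace T] (S : OrbitalSetup T D Φf) (μ : Measure T) (θ : T → ℂ) (f : Φf) : ℂ :=
  ∫ γ, θ γ * S.PhiT γ f ∂μ

end OrbitalSetup

/-- **Lemma 2.1** (typescript p. 5): «We may extend `γ ↦ Φ^T(γ, f)` to a smooth function on `T'` with compact support»; p. 5–8:
«what we must do is define `Φ^T(γ, f)` when `γ` is a scalar matrix in `G'` [Definitions 2.2, 2.3] and show that the resultant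
function is smooth in the neighbourhood of such a `γ`».  NON-ARCHIMEDEAN DRESS: smooth = locally constant.  PREDICATE on an
`OrbitalSetup` with a topology on `T'` and on the prescribed central values `cval γ f` (`γ ∉ reg`; print: `centralValueSplit` ∕
`centralValueNonsplit` at the scalar `γ = a`): the function equal to `Φ^T(γ, f)` on `reg` and to `cval γ f` off `reg` is locally
constant with compact support, for every `f`. [cite: LabesseLanglands1979, Lemma 2.1 (typescript p. 5)] -/
def LabesseLanglands1979_2_1_smoothExtension {T : Type u} {D : Type v} {Φf : Type w} [TopologicalSpace T] [Fintype D]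
    (S : OrbitalSetup T D Φf) [DecidablePred (· ∈ S.reg)] (cval : T → Φf → ℂ) : Prop :=
  ∀ f : Φf, IsLocallyConstant (S.reg.piecewise (fun γ => S.PhiT γ f) (fun γ => cval γ f)) ∧
    HasCompactSupport (S.reg.piecewise (fun γ => S.PhiT γ f) (fun γ => cval γ f))

section Central

variable {F : Type u} [Field F]

/-- **`γ(a) = a · (1 1; 0 1)`**, `a ∈ F^×` (typescript p. 6). [cite: LabesseLanglands1979, §2 (typescript p. 6)] -/
def unipotentScalar (a : F) : Matrix (Fin 2) (Fin 2) F :=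
  !![a, a; 0, a]

/-- **`κ#(h) = κ'(c₂) = κ'(−b₂)`** for `h = (a₂ b₂; c₂ d₂)` on the orbit `O(γ(a))` (typescript p. 7: «one of them is always
different from zero; so `κ#(h) = κ'(c₂) = κ'(−b₂)` is a well-defined function on `O(γ(a))`»); as a total function on `2 × 2`
matrices: `κ'(c₂)` if `c₂ ≠ 0`, else `κ'(−b₂)`.  «`κ#(h)` is to be identically `1` if `T` is split» (p. 8): instantiate `κ = 1`.
[cite: LabesseLanglands1979, §2 (typescript p. 7)] -/
def kappaSharp [DecidableEq F] (κ : F → ℂ) (h : Matrix (Fin 2) (Fin 2) F) : ℂ :=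
  if h 1 0 ≠ 0 then κ (h 1 0) else κ (-(h 0 1))

/-- Typescript p. 7: for `h = g⁻¹ γ(a) g = (a₂ b₂; c₂ d₂)` on `O(γ(a))` «if both `b₂` and `c₂` are not zero then their quotient
is a square [precisely: `c₂ ∕ (−b₂) = (r∕s)²` for `g = (p q; r s)`, which is what the next sentence uses].  Moreover, one of
them is always different from zero; so `κ#(h) = κ'(c₂) = κ'(−b₂)` is well-defined» for every `κ'` multiplicative on `F^×` and
trivial on squares (as is the character of `F^×∕Nm L^×`).  THEOREM over any field (review p848627 (1)): `g⁻¹ γ(a) g =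
a·1 + (a∕det g)·(rs, s²; −r², −rs)`, so `c₂ = −ar²∕det g`, `b₂ = as²∕det g`. [cite: LabesseLanglands1979, §2 (typescript p. 7)] -/
theorem LabesseLanglands1979_2_kappaSharp_wellDefined {a : F} (ha : a ≠ 0) (g : GL (Fin 2) F) :
    let h : Matrix (Fin 2) (Fin 2) F :=
      ((g⁻¹ : GL (Fin 2) F) : Matrix (Fin 2) (Fin 2) F) * unipotentScalar a * (g : Matrix (Fin 2) (Fin 2) F)
    (h 1 0 ≠ 0 ∨ h 0 1 ≠ 0) ∧
      (h 1 0 ≠ 0 → h 0 1 ≠ 0 → IsSquare (h 1 0 / -(h 0 1)) ∧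
        ∀ κ : F → ℂ, (∀ x y : F, x ≠ 0 → y ≠ 0 → κ (x * y) = κ x * κ y) → (∀ x : F, x ≠ 0 → κ (x ^ 2) = 1) →
          κ (h 1 0) = κ (-(h 0 1))) := by
  have hD : (g : Matrix (Fin 2) (Fin 2) F).det ≠ 0 := (Matrix.isUnits_det_units g).ne_zero
  set D := (g : Matrix (Fin 2) (Fin 2) F).det with hDdef
  have hdet : D = (g : Matrix (Fin 2) (Fin 2) F) 0 0 * (g : Matrix (Fin 2) (Fin 2) F) 1 1 -
      (g : Matrix (Fin 2) (Fin 2) F) 0 1 * (g : Matrix (Fin 2) (Fin 2) F) 1 0 := by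
    rw [hDdef, Matrix.det_fin_two]
  have hinv : ((g⁻¹ : GL (Fin 2) F) : Matrix (Fin 2) (Fin 2) F) = D⁻¹ • (g : Matrix (Fin 2) (Fin 2) F).adjugate := by
    rw [Matrix.coe_units_inv, Matrix.inv_def, Ring.inverse_eq_inv']
  have h10 : (((g⁻¹ : GL (Fin 2) F) : Matrix (Fin 2) (Fin 2) F) * unipotentScalar a * (g : Matrix (Fin 2) (Fin 2) F)) 1 0 =
      -(D⁻¹ * a * (g : Matrix (Fin 2) (Fin 2) F) 1 0 ^ 2) := by
    rw [hinv, Matrix.adjugate_fin_two]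
    simp [unipotentScalar, Matrix.mul_apply, Fin.sum_univ_two]
    ring
  have h01 : (((g⁻¹ : GL (Fin 2) F) : Matrix (Fin 2) (Fin 2) F) * unipotentScalar a * (g : Matrix (Fin 2) (Fin 2) F)) 0 1 =
      D⁻¹ * a * (g : Matrix (Fin 2) (Fin 2) F) 1 1 ^ 2 := by
    rw [hinv, Matrix.adjugate_fin_two]
    simp [unipotentScalar, Matrix.mul_apply, Fin.sum_univ_two]
    ring
  have hDa : D⁻¹ * a ≠ 0 := mul_ne_zero (inv_ne_zero hD) ha
  simp only [h10, h01]
  refine ⟨?_, fun hr hs => ⟨?_, fun κ hmul hsq => ?_⟩⟩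
  · -- one of `r = g 1 0`, `s = g 1 1` is non-zero since `det g ≠ 0`
    by_contra h
    rw [not_or, not_ne_iff, not_ne_iff] at h
    obtain ⟨hr, hs⟩ := h
    have hr' : (g : Matrix (Fin 2) (Fin 2) F) 1 0 = 0 := by
      simpa [hDa] using hr
    have hs' : (g : Matrix (Fin 2) (Fin 2) F) 1 1 = 0 := by
      simpa [hDa] using hs
    exact hD (by rw [hdet, hr', hs']; ring)
  · -- `c₂ ∕ (−b₂) = (r∕s)²`
    have hs' : (g : Matrix (Fin 2) (Fin 2) F) 1 1 ≠ 0 := by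
      rintro h; exact hs (by rw [h]; ring)
    refine ⟨(g : Matrix (Fin 2) (Fin 2) F) 1 0 / (g : Matrix (Fin 2) (Fin 2) F) 1 1, ?_⟩
    field_simp
  · -- `κ(c₂) = κ((r∕s)²) κ(−b₂) = κ(−b₂)`
    have hr' : (g : Matrix (Fin 2) (Fin 2) F) 1 0 ≠ 0 := by
      rintro h; exact hr (by rw [h]; ring)
    have hs' : (g : Matrix (Fin 2) (Fin 2) F) 1 1 ≠ 0 := by
      rintro h; exact hs (by rw [h]; ring)
    have hfac : -(D⁻¹ * a * (g : Matrix (Fin 2) (Fin 2) F) 1 0 ^ 2) =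
        ((g : Matrix (Fin 2) (Fin 2) F) 1 0 / (g : Matrix (Fin 2) (Fin 2) F) 1 1) ^ 2 *
          -(D⁻¹ * a * (g : Matrix (Fin 2) (Fin 2) F) 1 1 ^ 2) := by
      field_simp
    have hne : -(D⁻¹ * a * (g : Matrix (Fin 2) (Fin 2) F) 1 1 ^ 2) ≠ 0 :=
      neg_ne_zero.2 (mul_ne_zero hDa (pow_ne_zero 2 hs'))
    rw [hfac, hmul _ _ (pow_ne_zero 2 (div_ne_zero hr' hs')) hne, hsq _ (div_ne_zero hr' hs'), one_mul]

/-- **Definition 2.2** (typescript p. 6): «If `T` is split and `a` lies in the centre of `T'` set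
`Φ^T(a, f) = (1∕|a|) ∫_{O(γ(a))} f(h) dh`».  Parameters: `abs = |·|_F`; `orbInt a φ = ∫_{O(γ(a))} φ(h) |ω_{γ(a)}|` the invariant
integral over the orbit of `γ(a)` (measure `|ω_{γ(a)}|` of [9], p. 6; NOT typed); test functions as functions on `2 × 2` matrices.
[cite: LabesseLanglands1979, Definition 2.2 (typescript p. 6)] -/
def centralValueSplit (abs : F →*₀ ℝ≥0) (orbInt : F → (Matrix (Fin 2) (Fin 2) F → ℂ) → ℂ) (a : F)
    (f : Matrix (Fin 2) (Fin 2) F → ℂ) : ℂ :=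
  (((abs a)⁻¹ : ℝ≥0) : ℂ) * orbInt a f

/-- **Definition 2.3** (typescript p. 7): «If `T` is not split and `a` lies in the centre of `T'` set
`Φ^T(a, f) = λ(L∕F, ψ) κ'((τ − τ̄)∕(γ₁⁰ − γ₂⁰)) (1∕|a|) ∫_{O(γ(a))} κ#(h) f(h) |ω_{γ(a)}|`»; in the coordinates of p. 6
(`γ⁰ = a⁰ + b⁰τ`, `γ₁⁰ − γ₂⁰ = b⁰(τ − τ̄)`) the argument of `κ'` is `1∕b⁰`.  Parameters as in `centralValueSplit`, `dFactorCoord`.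
[cite: LabesseLanglands1979, Definition 2.3 (typescript p. 7)] -/
def centralValueNonsplit [DecidableEq F] (lam : ℂ) (κ : F → ℂ) (abs : F →*₀ ℝ≥0) (b₀ : F)
    (orbInt : F → (Matrix (Fin 2) (Fin 2) F → ℂ) → ℂ) (a : F) (f : Matrix (Fin 2) (Fin 2) F → ℂ) : ℂ :=
  lam * κ b₀⁻¹ * (((abs a)⁻¹ : ℝ≥0) : ℂ) * orbInt a (fun h => kappaSharp κ h * f h)

end Central

/-! ## The computation on the tree: `δ_m`, (2.1), (2.2), the supplement (typescript pp. 8–10) -/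

section Tree

variable {F : Type u} [Field F] [ValuativeRel F]

/-- «We may assume that **`f(k⁻¹ g k) = κ'(det k) f(g)`, `k ∈ G(O_F)`**» (typescript p. 8; obtained by replacing `f` with
`g ↦ ∫_{G(O_F)} f(k⁻¹ g k) κ'(det k) dk`); `G(O_F)` (p. 8: the stabiliser of `O_L = O_F + O_F τ` in `G̃(F)`, i.e. `GL₂(O_F)`) is
the tree's ★ `Literature.NumberTheory.Automorphic.glInt 2 F`. [cite: LabesseLanglands1979, §2 (typescript p. 8)] -/
def IsKappaSpherical (κ : F → ℂ) (f : Matrix (Fin 2) (Fin 2) F → ℂ) : Prop :=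
  ∀ k ∈ glInt 2 F, ∀ g : Matrix (Fin 2) (Fin 2) F,
    f (((k⁻¹ : GL (Fin 2) F) : Matrix (Fin 2) (Fin 2) F) * g * (k : Matrix (Fin 2) (Fin 2) F)) =
      κ (k : Matrix (Fin 2) (Fin 2) F).det * f g

/-- **The index `δ_m = [T(F) (1 0; 0 ϖ^m) G(O_F) : F^× G(O_F)]`** (typescript p. 8): «If `L` is unramified … `δ₀ = 1`,
`δ_m = (q + 1)q^{m−1}`, `m > 0`.  If `L` is ramified `δ_m = 2q^m`.  Here `q` is the number of elements in the residue field»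
(the natural subtraction `m − 1` only occurs for `m > 0`).  The tree proves the ramified count `2q^m` on the tree of `SL₂` in its
own currency: ★ `HermitianLatticeTree.ncard_setOf_glVertexAct_torus_eq_self_sep_shellIndex`. [cite: LabesseLanglands1979, §2 (typescript p. 8)] -/
def shellIndex (ramified : Bool) (q m : ℕ) : ℕ :=
  if ramified then 2 * q ^ m else if m = 0 then 1 else (q + 1) * q ^ (m - 1)

/-- The matrix **`(a, b v ϖ^m; b ϖ^{−m}, a + b u)`** of (2.1) (typescript p. 8), a representative of the `m`-th double coset
met by the orbit of `γ = a + bτ` (`τ² = uτ + v`, `{1, τ}` an `O_F`-basis of `O_L`, `ϖ` a generator of the maximal ideal of `O_F`).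
[cite: LabesseLanglands1979, §2 (2.1) (typescript p. 8)] -/
def shellMatrix (u v ϖ a b : F) (m : ℕ) : Matrix (Fin 2) (Fin 2) F :=
  !![a, b * v * ϖ ^ m; b * ϖ⁻¹ ^ m, a + b * u]

/-- **(2.1)** (typescript pp. 8–9): for `T` not split, `{1, τ}` an `O_F`-basis of `O_L` (arranged «at a cost of no more than a
change of sign for `Φ^T(·, f)`»), `f` with `f(k⁻¹gk) = κ'(det k)f(g)` for `k ∈ G(O_F)`, `ϖ` a generator of the maximal ideal of
`O_F`, `q = #𝓀_F`, and `γ = a + bτ` regular (`b ≠ 0`): «apart from a constant that does not depend on `f` or on `γ`, the function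
`Φ^T(γ, f)` is given by `Σ_{m=0}^{∞} κ'(bϖ^{−m}) |b| δ_m f((a, bvϖ^m; bϖ^{−m}, a + bu))`».  The series has finitely many non-zero
terms (`f` has compact support), which is how it is typed: for every `N` beyond which the terms vanish, the value is the finite
sum up to `N`.  PREDICATE on the datum `(κ', u, v, ϖ, ramified?, Φ^T)`, `Φ^T a b f` = the value at `γ = a + bτ`; `|·| = |·|_F`
(`normAbs`), `q = residueFieldCard F`.  `c ≠ 0` is ADDED to the print's «a constant that does not depend on `f` or on `γ`»: the
constant is a ratio of Haar-measure normalisations (p. 8 «apart from a constant»), never zero. [cite: LabesseLanglands1979, §2 (2.1) (typescript pp. 8–9)] -/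
def LabesseLanglands1979_2_eq_2_1_shellExpansion [TopologicalSpace F] [IsNonarchimedeanLocalField F] (κ : F → ℂ)
    (u v ϖ : F) (ramified : Bool) (PhiT : F → F → (Matrix (Fin 2) (Fin 2) F → ℂ) → ℂ) : Prop :=
  ∃ c : ℂ, c ≠ 0 ∧ ∀ f : Matrix (Fin 2) (Fin 2) F → ℂ, IsKappaSpherical κ f → ∀ a b : F, b ≠ 0 →
    ∀ N : ℕ, (∀ m : ℕ, N < m → f (shellMatrix u v ϖ a b m) = 0) →
      PhiT a b f = c * ∑ m ∈ Finset.range (N + 1),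
        κ (b * ϖ⁻¹ ^ m) * ((normAbs F b : ℝ≥0) : ℂ) * (shellIndex ramified (residueFieldCard F) m : ℂ) *
          f (shellMatrix u v ϖ a b m)

/-- **(2.2)** (typescript p. 9): «`∫_{|x| < |ϖ|^N} κ'(x) dx = 0`» — for `L∕F` RAMIFIED, when `κ'` (the character of `F^×∕Nm L^×`)
is non-trivial on the units `O_F^×`; `dx` a Haar measure of `F`.  THEOREM (review p848627 (1)), for any function `κ` on a
non-archimedean local field admitting a unit `ε` (`|ε|_F = 1`) with `κ(ε) ≠ 1` and `κ(εx) = κ(ε)κ(x)` (all `x`), over every ball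
`{|x|_F < r}`: the substitution `x ↦ εx` (★ `LocalFieldHaar.integral_comp_mul_left_of_normAbs_eq_one`) preserves the ball and the
Haar measure and multiplies the integral by `κ(ε)`, so `(1 − κ(ε))·I = 0` (no integrability needed: Bochner junk `0` is consistent).
[cite: LabesseLanglands1979, §2 (2.2) (typescript p. 9)] -/
theorem LabesseLanglands1979_2_eq_2_2_ramifiedVanishing [TopologicalSpace F] [IsNonarchimedeanLocalField F]
    [MeasurableSpace F] [BorelSpace F] (μ : Measure F) [μ.IsAddHaarMeasure] (κ : F → ℂ) {ε : F}
    (hε : normAbs F ε = 1) (hκε : κ ε ≠ 1) (hmul : ∀ x : F, κ (ε * x) = κ ε * κ x) (r : ℝ≥0) :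
    ∫ x in {x : F | normAbs F x < r}, κ x ∂μ = 0 := by
  set S : Set F := {x : F | normAbs F x < r} with hSdef
  have hSm : MeasurableSet S :=
    (isOpen_Iio.preimage (LocalFieldHaar.continuous_normAbs (F := F))).measurableSet
  have hS : ∀ x : F, ε * x ∈ S ↔ x ∈ S := by
    intro x
    simp only [hSdef, Set.mem_setOf_eq, map_mul, hε, one_mul]
  have hind : ∀ x : F, S.indicator κ (ε * x) = κ ε * S.indicator κ x := by
    intro x
    by_cases hx : x ∈ S
    · rw [Set.indicator_of_mem ((hS x).2 hx), Set.indicator_of_mem hx, hmul]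
    · rw [Set.indicator_of_notMem (fun h => hx ((hS x).1 h)), Set.indicator_of_notMem hx, mul_zero]
  have key : ∫ x in S, κ x ∂μ = κ ε * ∫ x in S, κ x ∂μ := by
    calc ∫ x in S, κ x ∂μ = ∫ x, S.indicator κ x ∂μ := (integral_indicator hSm).symm
      _ = ∫ x, S.indicator κ (ε * x) ∂μ :=
          (LocalFieldHaar.integral_comp_mul_left_of_normAbs_eq_one μ (S.indicator κ) hε).symm
      _ = ∫ x, κ ε * S.indicator κ x ∂μ := by simp_rw [hind]
      _ = κ ε * ∫ x in S, κ x ∂μ := by rw [integral_const_mul, integral_indicator hSm]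
  have h0 : (1 - κ ε) * ∫ x in S, κ x ∂μ = 0 := by rw [sub_mul, one_mul, ← key, sub_self]
  exact (mul_eq_zero.1 h0).resolve_left (sub_ne_zero.2 (Ne.symm hκε))

/-- The UNRAMIFIED companion of (2.2) (typescript p. 9): «`∫_{|x| < |bϖ^{−1}|} κ'(x) dx = Σ_{m=0}^{∞} κ'(bϖ^m)|bϖ^m| =
κ'(b)|b| ∕ (1 + q⁻¹)`».  THEOREM (review p848627 (1)–(2)): the SECOND equality, on the print's data — `κ` multiplicative on `F^×`
with `κ(ϖ) = −1` (`κ'` unramified), `|ϖ|_F = q⁻¹` (`ϖ` a uniformiser, `q = #𝓀_F`), `b ≠ 0`: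
`Σ_m κ(bϖ^m)|bϖ^m|_F = κ(b)|b|_F ∕ (1 + q⁻¹)` (the geometric series with ratio `−q⁻¹`).  The first equality (unfolding the integral
over the shells `|x| = |bϖ^m|`, «apart from a factor») is a Haar-measure normalisation and is not typed.
[cite: LabesseLanglands1979, §2 (typescript p. 9)] -/
theorem LabesseLanglands1979_2_eq_2_2_unramifiedSum [TopologicalSpace F] [IsNonarchimedeanLocalField F]
    (κ : F → ℂ) (hmul : ∀ x y : F, x ≠ 0 → y ≠ 0 → κ (x * y) = κ x * κ y) {ϖ b : F} (hb : b ≠ 0)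
    (hκϖ : κ ϖ = -1) (hϖ : normAbs F ϖ = ((residueFieldCard F : ℝ≥0))⁻¹) :
    HasSum (fun m : ℕ => κ (b * ϖ ^ m) * ((normAbs F (b * ϖ ^ m) : ℝ≥0) : ℂ))
      (κ b * ((normAbs F b : ℝ≥0) : ℂ) / (1 + ((residueFieldCard F : ℂ))⁻¹)) := by
  have hq0 : (residueFieldCard F : ℝ≥0) ≠ 0 := Nat.cast_ne_zero.2 (residueFieldCard_ne_zero F)
  have hq1 : 1 < (residueFieldCard F : ℝ) := by exact_mod_cast one_lt_residueFieldCard F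
  have hϖ0 : ϖ ≠ 0 := by
    intro h
    rw [h, map_zero] at hϖ
    exact inv_ne_zero hq0 hϖ.symm
  -- `κ 1 = 1` and `κ (ϖ ^ m) = (−1)^m`
  have hκ1 : κ 1 = 1 := by
    have h := hmul ϖ 1 hϖ0 one_ne_zero
    rw [mul_one, hκϖ] at h
    have h2 : (-1 : ℂ) * κ 1 = -1 * 1 := by rw [mul_one]; exact h.symm
    exact mul_left_cancel₀ (by norm_num) h2
  have hκpow : ∀ m : ℕ, κ (ϖ ^ m) = (-1) ^ m := by
    intro m
    induction m with
    | zero => rw [pow_zero, pow_zero, hκ1]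
    | succ m ih => rw [pow_succ, hmul _ _ (pow_ne_zero m hϖ0) hϖ0, ih, hκϖ, pow_succ]
  have hterm : (fun m : ℕ => κ (b * ϖ ^ m) * ((normAbs F (b * ϖ ^ m) : ℝ≥0) : ℂ)) =
      fun m : ℕ => κ b * ((normAbs F b : ℝ≥0) : ℂ) * ((-1 : ℂ) * ((residueFieldCard F : ℂ))⁻¹) ^ m := by
    funext m
    rw [hmul _ _ hb (pow_ne_zero m hϖ0), hκpow, map_mul, map_pow, hϖ, mul_pow]
    push_cast
    ring
  have hξ : ‖(-1 : ℂ) * ((residueFieldCard F : ℂ))⁻¹‖ < 1 := by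
    rw [norm_mul, norm_neg, norm_one, one_mul, norm_inv, Complex.norm_natCast]
    exact inv_lt_one_of_one_lt₀ hq1
  have h := (hasSum_geometric_of_norm_lt_one hξ).mul_left (κ b * ((normAbs F b : ℝ≥0) : ℂ))
  have h3 : κ b * ((normAbs F b : ℝ≥0) : ℂ) / (1 + ((residueFieldCard F : ℂ))⁻¹) =
      κ b * ((normAbs F b : ℝ≥0) : ℂ) * (1 - (-1 : ℂ) * ((residueFieldCard F : ℂ))⁻¹)⁻¹ := by
    rw [div_eq_mul_inv]
    congr 1
    ring
  rw [hterm, h3]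
  exact h

/-- **Supplement, `L` ramified** (typescript p. 9): «Suppose `f` is the restriction to `G'` of the characteristic function of
`G(O_F)` divided by its measure.  It is clear that `Φ^T(γ, f) = 0` if `L` is ramified» (for every regular `γ`).  PREDICATE on an
`OrbitalSetup` and the element `f⁰`. [cite: LabesseLanglands1979, §2 (typescript p. 9)] -/
def LabesseLanglands1979_2_supplement_ramified {T : Type u} {D : Type v} {Φf : Type w} [Fintype D]
    (S : OrbitalSetup T D Φf) (f₀ : Φf) : Prop :=
  ∀ γ ∈ S.reg, S.PhiT γ f₀ = 0

/-- **Supplement, `L` unramified** (typescript pp. 9–10): with `f⁰` as above, «if `L` is unramified and `T(F)` intersected with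
`G(O_F)`, which we denote `T(O_F)`, corresponds to the units of `O_L` then `Φ^T(γ, f⁰)` is `0` unless `γ` is a unit, but then … it
is given by `(meas T(O_F))⁻¹`» (for regular `γ`).  PREDICATE on an `OrbitalSetup`, `f⁰`, the unit predicate `IsUnitElt` (print:
`γ ∈ O_L^×`) and the real number `measTO = meas T(O_F)`. [cite: LabesseLanglands1979, §2 (typescript pp. 9–10)] -/
def LabesseLanglands1979_2_supplement_unramified {T : Type u} {D : Type v} {Φf : Type w} [Fintype D]
    (S : OrbitalSetup T D Φf) (f₀ : Φf) (IsUnitElt : T → Prop) [DecidablePred IsUnitElt] (measTO : ℝ) : Prop :=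
  ∀ γ ∈ S.reg, S.PhiT γ f₀ = if IsUnitElt γ then (((measTO⁻¹ : ℝ)) : ℂ) else 0

/-- The displayed computation of the unramified supplement (typescript p. 10): for `|b| = |ϖ|^n`,
«`(−1)^n q^{−n} + (1 + q⁻¹) Σ_{m=1}^{n} (−1)^{n−m} q^{m−n} = 1`» (times `(meas T(O_F))⁻¹` on both sides).  THEOREM (review
p848627 (1)) for every real `q ≠ 0` and every `n` (`q^{m−n}` written `q^m · (q⁻¹)^n`): the alternating sum
`T_n = Σ_{m=1}^{n} (−1)^{n−m} q^m` satisfies `(q + 1)T_n = q^{n+1} − (−1)^n q` (induction), the rest is bookkeeping (sanity also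
by exact rational arithmetic, `n ≤ 8`, folder `scratch/supplement_check.py`). [cite: LabesseLanglands1979, §2 (typescript p. 10)] -/
theorem LabesseLanglands1979_2_supplement_identity (q : ℝ) (hq : q ≠ 0) (n : ℕ) :
    (-1 : ℝ) ^ n * q⁻¹ ^ n + (1 + q⁻¹) * ∑ m ∈ Finset.Icc 1 n, (-1 : ℝ) ^ (n - m) * (q ^ m * q⁻¹ ^ n) = 1 := by
  -- the alternating sum and its closed form
  have key : ∀ n : ℕ, (q + 1) * ∑ m ∈ Finset.Icc 1 n, (-1 : ℝ) ^ (n - m) * q ^ m = q ^ (n + 1) - (-1) ^ n * q := by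
    intro n
    induction n with
    | zero => simp
    | succ n ih =>
      rw [Finset.sum_Icc_succ_top (by omega), Nat.sub_self, pow_zero, one_mul]
      have hre : ∑ m ∈ Finset.Icc 1 n, (-1 : ℝ) ^ (n + 1 - m) * q ^ m =
          -∑ m ∈ Finset.Icc 1 n, (-1 : ℝ) ^ (n - m) * q ^ m := by
        rw [← Finset.sum_neg_distrib]
        refine Finset.sum_congr rfl fun m hm => ?_
        rw [Finset.mem_Icc] at hm
        rw [show n + 1 - m = (n - m) + 1 by omega, pow_succ]
        ring
      rw [hre, mul_add, mul_neg, ih]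
      ring
  have hfac : ∑ m ∈ Finset.Icc 1 n, (-1 : ℝ) ^ (n - m) * (q ^ m * q⁻¹ ^ n) =
      q⁻¹ ^ n * ∑ m ∈ Finset.Icc 1 n, (-1 : ℝ) ^ (n - m) * q ^ m := by
    rw [Finset.mul_sum]
    refine Finset.sum_congr rfl fun m _ => ?_
    ring
  have h1 : (1 + q⁻¹) = q⁻¹ * (q + 1) := by field_simp
  rw [hfac, h1, mul_assoc, mul_left_comm (q + 1), key n]
  have hqn : q⁻¹ ^ n * q ^ n = 1 := by rw [← mul_pow, inv_mul_cancel₀ hq, one_pow]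
  have hqn1 : q⁻¹ * (q⁻¹ ^ n * q ^ (n + 1)) = 1 := by
    rw [pow_succ, ← mul_assoc (q⁻¹ ^ n), hqn, one_mul, inv_mul_cancel₀ hq]
  calc (-1 : ℝ) ^ n * q⁻¹ ^ n + q⁻¹ * (q⁻¹ ^ n * (q ^ (n + 1) - (-1) ^ n * q))
      = (-1 : ℝ) ^ n * q⁻¹ ^ n + (q⁻¹ * (q⁻¹ ^ n * q ^ (n + 1)) - (-1) ^ n * q⁻¹ ^ n * (q⁻¹ * q)) := by ring
    _ = 1 := by rw [hqn1, inv_mul_cancel₀ hq]; ring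

end Tree

/-! ## Restriction from `G̃(F) = GL₂(F)` to `G'`: Lemmas 2.4–2.6, Corollary 2.7, Lemma 2.8 (typescript pp. 10–14) -/

/-- The objects of typescript pp. 10–14 for the pair `G' ⊆ G̃(F) = GL₂(F)`: the (equivalence classes of) irreducible admissible
representations of `G̃(F)` (`IrrGL`) and of `G'` (`IrrG`), the multiplicity `mult π' π̃` of `π'` in the restriction of `π̃` to
`G'`, the conjugation action `conj g π' = (h ↦ π'(g⁻¹hg))` of `G̃(F)` on representations of `G'` (p. 15), the twist
`twist ω π̃ = π̃ ⊗ ω` by characters `ω` of `G̃(F)` (p. 12), and «`π'` is a component of `Ind(G', N(F), ψ')`» (`generic`, p. 12;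
`N(F)` the upper unipotent matrices, `ψ'` a non-trivial additive character of `F`).  CARRIER only (no axioms); concrete currency
for the representation types: ★ `Representation.IsSmooth` ∕ `Representation.IsAdmissible` (`SmoothRepresentation.lean`).
[cite: LabesseLanglands1979, §2 (typescript pp. 10–12)] -/
structure RestrictionDatum (F : Type u) [Field F] where
  /-- the subgroup `A ⊆ F^×` with `G' = GPrime F A` -/
  A : Subgroup Fˣ
  /-- irreducible admissible representations of `G̃(F) = GL₂(F)` up to equivalence -/
  IrrGL : Type v
  /-- irreducible admissible representations of `G'` up to equivalence (same universe as `IrrGL`) -/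
  IrrG : Type v
  /-- multiplicity of `π'` in `π̃|_{G'}` -/
  mult : IrrG → IrrGL → ℕ
  /-- `g · π' = (h ↦ π'(g⁻¹ h g))` -/
  conj : GL (Fin 2) F → IrrG → IrrG
  /-- `π̃ ↦ π̃ ⊗ ω` -/
  twist : (GL (Fin 2) F →* ℂˣ) → IrrGL → IrrGL
  /-- `π'` is a constituent of `Ind(G', N(F), ψ')` -/
  generic : IrrG → AddChar F ℂ → Prop

namespace RestrictionDatum

variable {F : Type u} [Field F] (R : RestrictionDatum.{u, v} F)

/-- **`G(π')`** = «the group of all `g ∈ G̃(F)` for which `h ↦ π'(g⁻¹hg)`, `h ∈ G'`, is equivalent to `π'`» (typescript p. 12).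
[cite: LabesseLanglands1979, §2 (typescript p. 12)] -/
def GOf (π : R.IrrG) : Set (GL (Fin 2) F) :=
  {g | R.conj g π = π}

/-- **`X(π̃)`** = «the set of all characters `ω` of `G̃(F)∕G'` for which `π̃ ⊗ ω ≃ π̃`» (typescript p. 12; «any `ω` in `X(π̃)` is
trivial on squares and hence of order two»). [cite: LabesseLanglands1979, §2 (typescript p. 12)] -/
def XSet (πt : R.IrrGL) : Set (GL (Fin 2) F →* ℂˣ) :=
  {ω | (∀ g ∈ GPrime F R.A, ω g = 1) ∧ R.twist ω πt = πt}

/-- **`L`-indistinguishability** (typescript p. 15): «two irreducible admissible representations `π₁', π₂'` of `G'` are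
`L`-indistinguishable if they both occur in the restriction of an irreducible, admissible representation of `G̃(F)` to `G'`».
[cite: LabesseLanglands1979, §2 (typescript p. 15)] -/
def IsLIndistinguishable (π₁ π₂ : R.IrrG) : Prop :=
  ∃ πt : R.IrrGL, 0 < R.mult π₁ πt ∧ 0 < R.mult π₂ πt

end RestrictionDatum

section Restriction

variable {F : Type u} [Field F] (R : RestrictionDatum.{u, v} F)

/-- **Lemma 2.4** (typescript p. 10): «If `π̃` is an irreducible admissible representation of `G̃(F)` then the restriction of
`π̃` to `G'` is the direct sum of finitely many irreducible representations» — typed as: the constituents of `π̃|_{G'}` form a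
finite non-empty set.  PREDICATE on the datum. [cite: LabesseLanglands1979, Lemma 2.4 (typescript p. 10)] -/
def LabesseLanglands1979_2_4_restrictionFinite : Prop :=
  ∀ πt : R.IrrGL, {π : R.IrrG | 0 < R.mult π πt}.Finite ∧ {π : R.IrrG | 0 < R.mult π πt}.Nonempty

/-- **Lemma 2.5** (typescript p. 10): «If `π'` is an irreducible admissible representation of `G'` then there exists an
irreducible admissible representation `π̃` of `G̃(F)` which contains `π'`.»  PREDICATE on the datum.
[cite: LabesseLanglands1979, Lemma 2.5 (typescript p. 10)] -/
def LabesseLanglands1979_2_5_extensionExists : Prop :=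
  ∀ π : R.IrrG, ∃ πt : R.IrrGL, 0 < R.mult π πt

/-- **Lemma 2.6** (typescript p. 11): «The restriction of `π̃` to `G'` contains no representation `π'` with multiplicity greater
than one.»  PREDICATE on the datum. [cite: LabesseLanglands1979, Lemma 2.6 (typescript p. 11)] -/
def LabesseLanglands1979_2_6_multiplicityOne : Prop :=
  ∀ (π : R.IrrG) (πt : R.IrrGL), R.mult π πt ≤ 1

/-- **Corollary 2.7** (typescript p. 13): «Suppose `π'` is a component of `Ind(G', N(F), ψ')`.  Then it is also a component of
`Ind(G', N(F), ψ₁')` if and only if `ψ₁'(x) ≡ ψ'(βx)` for some `β` in `{det g ∣ g ∈ G(π')}`» (`ψ', ψ₁'` non-trivial additive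
characters of `F`).  PREDICATE on the datum. [cite: LabesseLanglands1979, Corollary 2.7 (typescript p. 13)] -/
def LabesseLanglands1979_2_7_whittakerTwist : Prop :=
  ∀ (π : R.IrrG) (ψ ψ₁ : AddChar F ℂ), (∃ x, ψ x ≠ 1) → (∃ x, ψ₁ x ≠ 1) → R.generic π ψ →
    (R.generic π ψ₁ ↔ ∃ g ∈ R.GOf π, ∀ x : F, ψ₁ x = ψ (((Matrix.GeneralLinearGroup.det g : Fˣ) : F) * x))

/-- **Lemma 2.8** (typescript p. 13): «Suppose `π'` is a component of `π̃`.  The character `ω` [of `G̃(F)∕G'`] belongs to `X(π̃)` if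
and only if it is trivial on `G(π')`.  Moreover, the number of components of the restriction of `π̃` to `G'` is `|X(π̃)|`.»
PREDICATE on the datum (cardinalities as `Set.ncard`; both sets are finite in print: Lemma 2.4 and p. 10 `G̃(F)∕G' ≃ ℤ₂ⁿ`).
[cite: LabesseLanglands1979, Lemma 2.8 (typescript p. 13)] -/
def LabesseLanglands1979_2_8_componentsCount : Prop :=
  ∀ (πt : R.IrrGL) (π : R.IrrG), 0 < R.mult π πt →
    (∀ ω : GL (Fin 2) F →* ℂˣ, (∀ g ∈ GPrime F R.A, ω g = 1) → (ω ∈ R.XSet πt ↔ ∀ g ∈ R.GOf π, ω g = 1)) ∧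
      {π₂ : R.IrrG | 0 < R.mult π₂ πt}.ncard = (R.XSet πt).ncard

/-- Typescript p. 15, «in other words»: `π₁', π₂'` are `L`-indistinguishable iff «`π₂'` is equivalent to `h ↦ π₁'(g⁻¹hg)` for some
`g` in `G̃(F)`».  PREDICATE on the datum. [cite: LabesseLanglands1979, §2 (typescript p. 15)] -/
def LabesseLanglands1979_2_lindist_iff_conj : Prop :=
  ∀ π₁ π₂ : R.IrrG, R.IsLIndistinguishable π₁ π₂ ↔ ∃ g : GL (Fin 2) F, R.conj g π₁ = π₂

/-- Typescript p. 15: «This gives a partition of the equivalence classes of irreducible admissible representations of `G'` into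
finite sets» — `L`-indistinguishability is an equivalence relation with finite classes.  PREDICATE on the datum.
[cite: LabesseLanglands1979, §2 (typescript p. 15)] -/
def LabesseLanglands1979_2_lindist_partition : Prop :=
  Equivalence R.IsLIndistinguishable ∧ ∀ π : R.IrrG, {π₂ : R.IrrG | R.IsLIndistinguishable π π₂}.Finite

/-- Typescript p. 16: «In general, therefore, an `L`-indistinguishable class consists of `1`, `2`, or `4` elements» (p. 15: it is
`{π'}` alone if there is no `L, θ` with `π'` a component of `π(θ)` or the quadratic character of `L` is non-trivial on `G'`;
otherwise `2`, or `4` in the case of three fields `L₁, L₂, L₃`).  PREDICATE on the datum. [cite: LabesseLanglands1979, §2 (typescript pp. 15–16)] -/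
def LabesseLanglands1979_2_lindist_classCard : Prop :=
  ∀ π : R.IrrG, {π₂ : R.IrrG | R.IsLIndistinguishable π π₂}.ncard = 1 ∨
    {π₂ : R.IrrG | R.IsLIndistinguishable π π₂}.ncard = 2 ∨ {π₂ : R.IrrG | R.IsLIndistinguishable π π₂}.ncard = 4

end Restriction

/-! ## The character identities (2.4), (2.5) and the packets `Π^±(θ)`, `Π(θ')` (typescript pp. 14–17) -/

section Packets

variable {F : Type u} [Field F] {L : Type v} [CommRing L] [Algebra F L]

/-- **(2.4)** (typescript p. 14, quoted from [11] Lemma 5.18): for `ω` the quadratic character of `F^×` attached to `L`, `θ` a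
character of `L^× = T(F)`, `ψ` a non-trivial character of `F`, `γ⁰` a regular element of `T(F)`, the two components `π⁺(θ)`,
`π⁻(θ)` of `π(θ)|_{G(ω)}` are labelled so that «`χ_{π⁺(θ)}(γ) − χ_{π⁻(θ)}(γ) = λ(L∕F, ψ) ω((γ₁ − γ₂)∕(γ₁⁰ − γ₂⁰))
(θ(γ) + θ(wγw⁻¹)) ∕ Δ(γ)`», `θ(wγw⁻¹) = θ(γ̄)` (p. 15).  Typed in the coordinates of p. 6 ∕ p. 16 (`τ² = uτ + v`, `τ̄ = u − τ`,
`γ = a + bτ` regular ⇔ `b ≠ 0`, `γ⁰ = a⁰ + b⁰τ`, so the argument of `ω` is `b∕b⁰`) as a PREDICATE on the character values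
`χ⁺, χ⁻ : L → ℂ` on regular elements, `θ : L → ℂ`, `lam = λ(L∕F, ψ)`, `ω : F → ℂ`, `abs` (for `Δ`, see `deltaFactor`).
[cite: LabesseLanglands1979, §2 (2.4) (typescript p. 14)] -/
def LabesseLanglands1979_2_eq_2_4_characterDifference (χplus χminus θ : L → ℂ) (lam : ℂ) (ω : F → ℂ) (abs : L →*₀ ℝ≥0)
    (τ : L) (u b₀ : F) : Prop :=
  ∀ a b : F, b ≠ 0 →
    χplus (algebraMap F L a + algebraMap F L b * τ) - χminus (algebraMap F L a + algebraMap F L b * τ) =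
      lam * ω (b / b₀) *
        (θ (algebraMap F L a + algebraMap F L b * τ) + θ (algebraMap F L a + algebraMap F L b * (algebraMap F L u - τ))) /
        ((deltaFactor abs (algebraMap F L a + algebraMap F L b * τ) (algebraMap F L a + algebraMap F L b * (algebraMap F L u - τ))
          : ℝ≥0) : ℂ)

/-- **(2.5)** (typescript p. 15): with `Π⁺(θ)`, `Π⁻(θ)` the components of the restrictions of `π⁺(θ)`, `π⁻(θ)` to `G'`, «a simple
calculation shows that the map adjoint to `f ↦ Φ^T(f)` takes `θ'` to `Σ_{π' ∈ Π⁺(θ)} χ_{π'} − Σ_{π' ∈ Π⁻(θ)} χ_{π'}`», i.e.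
`∫_{T'} θ'(γ) Φ^T(γ, f) dγ = Σ_{Π⁺(θ)} χ_{π'}(f) − Σ_{Π⁻(θ)} χ_{π'}(f)` for all `f`.  PREDICATE on an `OrbitalSetup` with Haar
measure `μ` on `T'`, the character `θ'`, the distribution characters `char π' f = χ_{π'}(f)` and the finite sets `Π^±(θ)`.
[cite: LabesseLanglands1979, §2 (2.5) (typescript p. 15)] -/
def LabesseLanglands1979_2_eq_2_5_adjointOnCharacters {T : Type u} {D : Type v} {Φf : Type w} {Irr : Type*} [Fintype D]
    [MeasurableSpace T] (S : OrbitalSetup T D Φf) (μ : Measure T) (θ : T → ℂ) (char : Irr → Φf → ℂ)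
    (PiPlus PiMinus : Finset Irr) : Prop :=
  ∀ f : Φf, S.adjointPhiT μ θ f = ∑ π ∈ PiPlus, char π f - ∑ π ∈ PiMinus, char π f

/-- Typescript p. 17: «We set `Π(θ') = Π⁺(θ') ∪ Π⁻(θ')` … Consequently `Π(θ₁') = Π(θ₂')` if and only if `θ₁' = θ₂'` or
`θ̄₁' = θ₂'`» (`θ̄(γ) = θ(γ̄)`, p. 15).  PREDICATE on the packet map `Pi : Θ → Set Irr` (on a type `Θ` of characters `θ'` of `T'`)
and the conjugation `bar : Θ → Θ`. [cite: LabesseLanglands1979, §2 (typescript p. 17)] -/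
def LabesseLanglands1979_2_packet_eq_iff {Θ : Type u} {Irr : Type v} (Pi : Θ → Set Irr) (bar : Θ → Θ) : Prop :=
  ∀ θ₁ θ₂ : Θ, Pi θ₁ = Pi θ₂ ↔ (θ₁ = θ₂ ∨ bar θ₁ = θ₂)

end Packets

end Literature.NumberTheory.Automorphic.LabesseLanglands1979.Sec2

end
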